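import Summits.QuantumFields.BalabanUV.T4Continuum.Support.GramPerturbationLaw
import Summits.QuantumFields.BalabanUV.T4Continuum.Support.ColourCovariantLaplacian
import Summits.QuantumFields.BalabanUV.T4Continuum.Support.NE2FromNE3

/-!
# T⁴ programme, spine node NE2 (U1a) — THE TRANSPORTED SITE AVERAGING `Q_k(v) = Q^{(k)}·siteMul(v_k)` ([B9] (3.19) shape) and the
# (3.24)-SHAPED COVARIANT OPERATOR `Δ^R − Δ^1⊗1 + a(Q_k(v)ᴴQ_k(v) − Q^{(k)ᴴ}Q^{(k)})`: `PerturbationLaws` DISCHARGED, η-rate `L^{−k}`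
# (tier B of `t4/SKELETON-NE2-P1.md`, rows B3.a-model + B3.b + B2 assembled)

Tenth generation of the NE2 prover lineage P1 of the cell `pub-balaban`, file 2 (on top of file 1 `Support/GramPerturbationLaw` and generation 9's
`Support/ColourCovariantLaplacian`).  [Balaban1985BackgroundPropagators] p.393 (3.19) prints the covariant block averaging of 𝔤-valued SCALAR
functions «(Q′(U)λ)(y) = Σ_{x∈B(y)} L^{−d}R(U(Γ_{y,x}))λ(x), y ∈ T^{(j)}_{L^jη}» — the free site average of the field TRANSPORTED to the block
along the contours `Γ_{y,x}` — and p.394 (3.24) the operator «Δ′_a = Δ′_a(U) = (Δ_U + Q′*aQ′)» (single-domain reading: one term `j = k`,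
`L^kη = 1`) whose inverse `G′(U)` enters `R(U)` (3.25) and `Δ_a(U)` (3.26).  Here, at MODEL LEVEL (transporters `v_k(x) ∈ M_o(ℂ)` and colour
transporters `R^{(k)}_ν(x)` are DATA; the free operator is the tree's VECTOR `Δ_a ⊗ 1`, on which the shape is planted; global small field):

 * §1 **`BlockTransporters L M v α′ β′`** (hypothesis SHAPE on data): `‖v_k(x) − 1‖ ≤ α′` and the two-level consistency at the block parent
   `‖v_{k+1}(x′) − v_k(par x′)‖ ≤ β′/L^k` (for Bałaban's `v_k(x) = R(U_k(Γ_{y(x),x}))`: the background tower's two-level consistency summed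
   along nested contours — node NE3's currency, skeleton row B6 — plus the `O(η)` tail of the finer contour; NOT proved here);
   **`transportLaws_site`**: `TransportLaws (k ↦ siteMul (v k)) (k ↦ J_k ⊗ 1) α′ (k ↦ β′·L^{−k})` by King's pairing through colour
   multiplications (`BlockMultiplication.kronJK_mul_siteMul`: `(J⊗1)·siteMul w = siteMul(w∘par)·(J⊗1)`);
 * §2 **`perturbationLaws_transportedSite`**: for the lifted King tower (`Δ_a^{(k)}⊗1`, `Q_L⊗1`, `J_k⊗1`, `KroneckerLift.freeTowerLaws_kron`)
   `PerturbationLaws (Δ_a⊗1) (gramCore (Btow (Q_L⊗1) L^d) (Etrans (Q_L⊗1) L^d (siteMul v))) (J⊗1) (α′(2+α′)Cst) (C2site·L^{−k})`,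
   `C2site = C2gram Cst 1 α′ (2dCst) CJ 0 (Cst·β′)`; **`towerLimitRate_transportedSite`** (all orders in the coupling `t·c`) and the
   physical value (**`transportedSite_rate`**, `c = a`, `t = 1`, `a·α′(2+α′)Cst < 1`);
 * §3 THE (3.24)-SHAPED OPERATOR: **`perturbationLaws_covLapTransported`** = `perturbationLaws_add` of generation 9's
   `perturbationLaws_colourCovariantLaplacian` (row B2: `Δ^R − Δ^1⊗1 = F + Fᴴ + siteMul z`) and §2; **`towerLimitRate_covLapTransported`**,
   **`covLapTransported_rate`**: the lifted King-averaged unit-lattice covariance of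
   `(Δ_a^{(k)}⊗1 + (Δ^{R_k} − Δ^1⊗1) + a(Q_k(v)ᴴQ_k(v) − Q^{(k)ᴴ}Q^{(k)}⊗1))⁻¹` CONVERGES with rate `L^{−k}`, explicit constant, under the
   DISPLAYED small-field threshold `κ_col + a·α′(2+α′)Cst < 1`;
 * §4 THE DAG EDGE TO NODE NE3 (skeleton row B6, for transporters): **`blockTransporters_of_localRate`** — the two-level consistency (ii)
   of `BlockTransporters` IS node U1b/NE3's currency `T4EtaRateMin.LocalRate` for the readings `NE2FromNE3.bgReadings` of the tower
   `k ↦ (ν ↦ v_k)` (pure read-out through `NE2FromNE3.consistent_of_localRate_lev`); **`transportedSite_rate_of_localRate`**: §2's rate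
   CONDITIONAL on that `LocalRate` hypothesis BY NAME (no `Prop` mirror of NE3 is minted).

HONEST FRAMING (T4-DAG p. 1).  Model level: the free operator is the VECTOR `Δ_a⊗1` of [Balaban1984PropagatorsI] (1.69) (the tree's only free
tower with proved laws), NOT the scalar `−Δ + aQ′*Q′` of (3.24); the inner averaging perturbed is King's composite SITE averaging `Q^{(k)}`
(exact pairing), NOT the line-averaged vector `Q` of (1.61) that sits inside `Δ_a` — so §3 is the (3.24) SHAPE planted on the vector tower,
not Bałaban's `Δ′_a(U)` or `Δ_a(U)` themselves; transporters are data (no group structure, no contour geometry); finite torus, linear layer,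
operator norm; rates / pairings / constants OURS; nothing printed is a hypothesis; no `def … : Prop` fact; NOT infinite volume / mass gap /
Clay / summit progress; spine 0/9 unchanged.  HONEST DEPENDENCY: continuum YM on T⁴ ⇐ BetaPertH ∧ nine spine estimates (0/9 proved); BetaPertH
⇐ (D1) ∧ (D4) ∧ CAP+tail; G-an2-4 gates asym, D1 and NE2/3/4.  ABSOLUTE RULE kept; no `sorry`.
-/

noncomputable section

open scoped BigOperators ComplexConjugate Matrix Matrix.Norms.L2Operator Kronecker

namespace Summit.QuantumFields.BalabanUV.T4Continuum.TransportedSiteAveraging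

open Literature.MathematicalPhysics.QuantumFieldTheory.Balaban1983to89.B5Prop11Plancherel (Cst Cst_nonneg Tor fine)
open Literature.MathematicalPhysics.QuantumFieldTheory.Balaban1983to89.B5G183RateUnitTower (lev lev_neZero)
open Summit.QuantumFields.BalabanUV.T4Continuum
open Summit.QuantumFields.BalabanUV.T4Continuum.CovariantAveragingTower (TowerLimitRate)
open Summit.QuantumFields.BalabanUV.T4Continuum.BalabanAveragedTowerUnit (idx Qlev one_le_lev' cast_lev')
open Summit.QuantumFields.BalabanUV.T4Continuum.BackgroundResolventTower
open Summit.QuantumFields.BalabanUV.T4Continuum.KingPairingPlantedLaw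
open Summit.QuantumFields.BalabanUV.T4Continuum.BlockPairingGeometry (parT)
open Summit.QuantumFields.BalabanUV.T4Continuum.NE2PerturbedLayer
open Summit.QuantumFields.BalabanUV.T4Continuum.PerturbationAlgebra
open Summit.QuantumFields.BalabanUV.T4Continuum.KroneckerLift
open Summit.QuantumFields.BalabanUV.T4Continuum.BlockMultiplication
open Summit.QuantumFields.BalabanUV.T4Continuum.ColourCovariantLaplacian (covPertC kappaCol C2col perturbationLaws_colourCovariantLaplacian
  Vab Zab)
open Summit.QuantumFields.BalabanUV.T4Continuum.FirstOrderBackgroundModel (LipschitzBackground)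
open Summit.QuantumFields.BalabanUV.T4Continuum.GramPerturbationLaw

variable {d : ℕ} (L : ℕ) [NeZero L] (M : Fin d → ℕ) [hM : ∀ μ, NeZero (M μ)] {o : Type*} [Fintype o] [DecidableEq o]

/-! ## §1 Block transporters and their `TransportLaws` -/

/-- **BLOCK TRANSPORTERS SAMPLED AT EVERY SPACING** (hypothesis SHAPE on data): colour matrices `v_k(x)` at the sites of the lattice `L^{−k}`
(for Bałaban: `R(U_k(Γ_{y(x),x}))`, the adjoint transporter from `x` to its unit block along the printed contour) with (i) small field
`‖v_k(x) − 1‖ ≤ α′` and (ii) two-level consistency at the block parent `‖v_{k+1}(x′) − v_k(par x′)‖ ≤ β′/L^k`. [folklore] -/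
structure BlockTransporters (v : (k : ℕ) → idx L M k → Matrix o o ℂ) (α' β' : ℝ) : Prop where
  /-- `α′, β′ ≥ 0` -/
  nonneg : 0 ≤ α' ∧ 0 ≤ β'
  /-- (i) small field -/
  near_one : ∀ k i, ‖v k i - 1‖ ≤ α'
  /-- (ii) two-level consistency at the block parent -/
  consistent : ∀ k (i : idx L M (k + 1)), ‖v (k + 1) i - v k (parT (lev L k) L M i)‖ ≤ β' / (lev L k : ℕ)

/-- the transport family `T_k = siteMul(v_k)` on `(sites × components) × colours`. [folklore] -/
def Tsite (v : (k : ℕ) → idx L M k → Matrix o o ℂ) (k : ℕ) : Matrix (idx L M k × o) (idx L M k × o) ℂ := siteMul (v k)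

/-- the lifted King injections `J_k ⊗ 1`. [folklore] -/
def Jc (k : ℕ) : Matrix (idx L M (k + 1) × o) (idx L M k × o) ℂ := JpcT L M k ⊗ₖ (1 : Matrix o o ℂ)

/-- the lifted King one-step averagings `Q_L ⊗ 1`. [folklore] -/
def Ac (k : ℕ) : Matrix (idx L M k × o) (idx L M (k + 1) × o) ℂ := Qlev L M k ⊗ₖ (1 : Matrix o o ℂ)

variable (a : ℝ) (ha : 0 < a)

/-- the lifted free operators `Δ_a^{(k)} ⊗ 1`. [cite: Balaban1984PropagatorsI, (1.69) p.29, (1.73) p.30] [folklore] -/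
def Dc (k : ℕ) : Matrix (idx L M k × o) (idx L M k × o) ℂ := calDalev L M a ha k ⊗ₖ (1 : Matrix o o ℂ)

/-- the lifted King tower's laws (`F = 0 ⊗ 1`). [folklore] -/
theorem freeTowerLaws_c :
    FreeTowerLaws (Dc L M a ha) (Ac L M (o := o)) (Jc L M) (fun k => (0 : Matrix (idx L M k) (idx L M k) ℂ) ⊗ₖ (1 : Matrix o o ℂ))
      ((L : ℝ) ^ d) (fun k => 2 * d * Cst d a * ((L : ℝ)⁻¹) ^ k) (fun k => CJ d a * ((L : ℝ)⁻¹) ^ k) (fun _ => 0) :=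
  freeTowerLaws_kron o (freeTowerLaws_king L M a ha)

omit hM in
/-- `T_{k+1}(J⊗1) − (J⊗1)T_k`-type differences collapse: `(T′ − 1)J − J(T − 1) = T′J − JT`. [folklore] -/
theorem sub_one_intertwine {α β : Type*} [Fintype α] [Fintype β] [DecidableEq α] [DecidableEq β] (T' : Matrix β β ℂ)
    (T : Matrix α α ℂ) (J : Matrix β α ℂ) :
    (T' - 1) * J - J * (T - 1) = T' * J - J * T := by
  rw [Matrix.sub_mul, Matrix.one_mul, Matrix.mul_sub, Matrix.mul_one]; abel

/-- King's pairing through colour multiplications: `(siteMul v′ − 1)(J⊗1) − (J⊗1)(siteMul v − 1) = siteMul(v′ − v∘par)·(J⊗1)`.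
[cite: King1986, (2.10) p.653] [folklore] -/
theorem site_intertwine_eq (v : (k : ℕ) → idx L M k → Matrix o o ℂ) (k : ℕ) :
    (Tsite L M v (k + 1) - 1) * Jc L M (o := o) k - Jc L M (o := o) k * (Tsite L M v k - 1)
      = siteMul (fun i => v (k + 1) i - v k (parT (lev L k) L M i)) * Jc L M (o := o) k := by
  have h' : Jc L M (o := o) k * siteMul (v k) = siteMul (fun i : idx L M (k + 1) => v k (parT (lev L k) L M i)) * Jc L M (o := o) k :=
    kronJK_mul_siteMul (lev L k) L M (v k)
  rw [sub_one_intertwine, Tsite, Tsite, h', ← Matrix.sub_mul, ← siteMul_sub]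

/-- the two-level intertwining defect of site transporters: `≤ β′·L^{−k}`. [folklore] -/
theorem opNorm_site_intertwine_le {v : (k : ℕ) → idx L M k → Matrix o o ℂ} {α' β' : ℝ} (hv : BlockTransporters L M v α' β') (k : ℕ) :
    ‖(Tsite L M v (k + 1) - 1) * Jc L M (o := o) k - Jc L M (o := o) k * (Tsite L M v k - 1)‖ ≤ β' * ((L : ℝ)⁻¹) ^ k := by
  have hlev : (0 : ℝ) < (lev L k : ℕ) := by exact_mod_cast one_le_lev' L k
  have hJ : ‖Jc L M (o := o) k‖ ≤ 1 := opNorm_kron_le_of_le o (opNorm_JpcT_le L M k)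
  rw [site_intertwine_eq]
  calc _ ≤ ‖siteMul (fun i => v (k + 1) i - v k (parT (lev L k) L M i))‖ * ‖Jc L M (o := o) k‖ := Matrix.l2_opNorm_mul _ _
    _ ≤ (β' / (lev L k : ℕ)) * 1 := mul_le_mul (opNorm_siteMul_le _ (div_nonneg hv.nonneg.2 hlev.le) fun i => hv.consistent k i) hJ
        (norm_nonneg _) (div_nonneg hv.nonneg.2 hlev.le)
    _ = β' * ((L : ℝ)⁻¹) ^ k := by rw [mul_one, cast_lev', inv_pow, div_eq_mul_inv]

/-- **`TransportLaws` FOR SITE TRANSPORTERS**: `‖siteMul(v_k) − 1‖ ≤ α′` and the intertwining defect `≤ β′·L^{−k}`. [folklore] -/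
theorem transportLaws_site {v : (k : ℕ) → idx L M k → Matrix o o ℂ} {α' β' : ℝ} (hv : BlockTransporters L M v α' β') :
    TransportLaws (Tsite L M v) (Jc L M) α' (fun k => β' * ((L : ℝ)⁻¹) ^ k) where
  sub_one_le := fun k => by
    rw [Tsite, ← siteMul_one, ← siteMul_sub]
    exact opNorm_siteMul_le _ hv.nonneg.1 (hv.near_one k)
  intertwine_le := opNorm_site_intertwine_le L M hv

/-! ## §2 `PerturbationLaws` for the transported site averaging and the η-rate -/

/-- the transported-site-averaging perturbation `(Q_k(v))ᴴQ_k(v) − Q^{(k)ᴴ}Q^{(k)}` with `Q_k(v) = Btow·siteMul(v_k)`, `Q^{(k)} = Btow`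
(King's composite site averaging, isometrically normalised, lifted to colours). [folklore] -/
def sitePert (v : (k : ℕ) → idx L M k → Matrix o o ℂ) (k : ℕ) : Matrix (idx L M k × o) (idx L M k × o) ℂ :=
  gramCore (Btow (Ac L M (o := o)) ((L : ℝ) ^ d)) (Etrans (Ac L M (o := o)) ((L : ℝ) ^ d) (Tsite L M v)) k

/-- the consistency constant of the transported site averaging. [folklore] -/
def C2site (d : ℕ) (a α' β' : ℝ) : ℝ := C2gram (Cst d a) 1 α' (2 * d * Cst d a) (CJ d a) 0 (Cst d a * β')

/-- **`PerturbationLaws` DISCHARGED FOR THE TRANSPORTED SITE AVERAGING**: `κ = α′(2 + α′)Cst`, `e₂ k = C2site·L^{−k}`.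
[cite: Balaban1984PropagatorsI, Prop. 1.1 (1.89) p.33; King1986, (2.10) p.653, p.664; Balaban1985BackgroundPropagators, (3.19) p.393 (shape)]
[folklore] -/
theorem perturbationLaws_transportedSite {v : (k : ℕ) → idx L M k → Matrix o o ℂ} {α' β' : ℝ} (hv : BlockTransporters L M v α' β') :
    PerturbationLaws (Dc L M a ha) (sitePert L M (o := o) v) (Jc L M) (α' * (2 + α') * Cst d a)
      (fun k => C2site d a α' β' * ((L : ℝ)⁻¹) ^ k) := by
  have hr : (0 : ℝ) < (L : ℝ) ^ d := pow_pos (by exact_mod_cast Nat.pos_of_ne_zero (NeZero.ne L)) d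
  have hγ : ∀ k, ‖(Dc L M a ha (o := o) k)⁻¹‖ ≤ Cst d a := fun k => by
    rw [Dc, kron_inv]; exact opNorm_kron_le_of_le o (opNorm_inv_calDalev_le L M a ha k)
  have h := perturbationLaws_transportedGram hr (freeTowerLaws_c L M a ha) (fun k => Matrix.zero_kronecker _) hγ
    (transportLaws_site L M hv)
  refine perturbationLaws_mono h (le_of_eq (by ring)) fun k => ?_
  refine (e2gram_le_geom (ρ := (L : ℝ)⁻¹) (Cst_nonneg d a) zero_le_one hv.nonneg.1 (fun k => le_rfl) (fun k => le_rfl)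
    (fun k => le_of_eq (zero_mul _).symm) (fun k => le_of_eq (mul_assoc _ _ _).symm) k).trans (le_of_eq ?_)
  rfl

/-- **η-RATE FOR THE TRANSPORTED SITE AVERAGING** (`L ≥ 2`), all orders in the coupling: for `‖t‖·‖c‖·α′(2+α′)Cst < 1` the lifted King-averaged
unit-lattice covariances of `(Δ_a^{(k)}⊗1 + t·c·((Q_k(v))ᴴQ_k(v) − Q^{(k)ᴴ}Q^{(k)}))⁻¹` CONVERGE with rate `L^{−k}`, explicit constant.
[cite: King1986, Lemma 4.5 (4.32)/(4.38) p.674 (scalar template); Balaban1985BackgroundPropagators, (3.19) p.393, (3.24) p.394 (shapes)] [folklore] -/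
theorem towerLimitRate_transportedSite (hL : 2 ≤ L) {v : (k : ℕ) → idx L M k → Matrix o o ℂ} {α' β' : ℝ}
    (hv : BlockTransporters L M v α' β') (c : ℂ) {t : ℂ} (ht : ‖t‖ * (‖c‖ * (α' * (2 + α') * Cst d a)) < 1) :
    TowerLimitRate (Ac L M (o := o)) ((L : ℝ) ^ d) (fun k => (Dc L M a ha k + t • (c • sitePert L M (o := o) v k))⁻¹)
      (Cpert (‖c‖ * (α' * (2 + α') * Cst d a)) (2 * d * Cst d a) (CJ d a) (‖c‖ * C2site d a α' β') 0 t) ((L : ℝ)⁻¹) := by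
  have hL1 : (1 : ℝ) < L := by exact_mod_cast (lt_of_lt_of_le one_lt_two hL : 1 < L)
  have hr : (0 : ℝ) < (L : ℝ) ^ d := pow_pos (lt_trans zero_lt_one hL1) d
  have hP := perturbationLaws_smul c (perturbationLaws_transportedSite L M a ha hv)
  refine towerLimitRate_perturbed hr (freeTowerLaws_c L M a ha) hP (inv_lt_one_of_one_lt₀ hL1)
    (fun k => le_rfl) (fun k => le_rfl) (fun k => le_of_eq (mul_assoc _ _ _).symm) (fun k => ?_) ht
  simp only [zero_mul, le_refl]

/-- **THE PHYSICAL VALUE** `c = a`, `t = 1`, small field `a·α′(2+α′)Cst < 1`. [folklore] -/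
theorem transportedSite_rate (hL : 2 ≤ L) {v : (k : ℕ) → idx L M k → Matrix o o ℂ} {α' β' : ℝ} (hv : BlockTransporters L M v α' β')
    (hsmall : ‖(a : ℂ)‖ * (α' * (2 + α') * Cst d a) < 1) :
    TowerLimitRate (Ac L M (o := o)) ((L : ℝ) ^ d) (fun k => (Dc L M a ha k + (a : ℂ) • sitePert L M (o := o) v k)⁻¹)
      (Cpert (‖(a : ℂ)‖ * (α' * (2 + α') * Cst d a)) (2 * d * Cst d a) (CJ d a) (‖(a : ℂ)‖ * C2site d a α' β') 0 1) ((L : ℝ)⁻¹) := by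
  have h := towerLimitRate_transportedSite L M a ha hL hv (a : ℂ) (t := 1) (by rwa [norm_one, one_mul])
  simpa only [one_smul] using h

/-! ## §3 The (3.24)-shaped covariant operator: colour covariant Laplacian + transported site averaging -/

/-- **`PerturbationLaws` FOR THE (3.24)-SHAPED OPERATOR** `(Δ^{R_k} − Δ^1⊗1) + a·((Q_k(v))ᴴQ_k(v) − Q^{(k)ᴴ}Q^{(k)})`: the sum of row B2
(`perturbationLaws_colourCovariantLaplacian`) and §2. [cite: Balaban1985BackgroundPropagators, (3.23)-(3.24) p.394 (shape)] [folklore] -/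
theorem perturbationLaws_covLapTransported (hd : 1 ≤ d) {R : (k : ℕ) → Fin d → (idx L M k → Matrix o o ℂ)} {α β αz βz : ℝ}
    (hV : ∀ p : o × o, LipschitzBackground L M (Vab L M R p) α β) (hz : ∀ p : o × o, BoundedBackground L M (Zab L M R p) αz βz)
    {v : (k : ℕ) → idx L M k → Matrix o o ℂ} {α' β' : ℝ} (hv : BlockTransporters L M v α' β') :
    PerturbationLaws (Dc L M a ha) (fun k => covPertC L M R k + (a : ℂ) • sitePert L M (o := o) v k) (Jc L M)
      (kappaCol o d a α β αz + ‖(a : ℂ)‖ * (α' * (2 + α') * Cst d a))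
      (fun k => (C2col o d L a α β βz + ‖(a : ℂ)‖ * C2site d a α' β') * ((L : ℝ)⁻¹) ^ k) := by
  have h := perturbationLaws_add (perturbationLaws_colourCovariantLaplacian L M a ha hd hV hz)
    (perturbationLaws_smul (a : ℂ) (perturbationLaws_transportedSite L M a ha hv))
  exact perturbationLaws_mono h le_rfl fun k => le_of_eq (by ring)

/-- **η-RATE FOR THE (3.24)-SHAPED OPERATOR** (`L ≥ 2`, `d ≥ 1`): for `‖t‖·(κ_col + a·α′(2+α′)Cst) < 1` the lifted King-averaged unit-lattice
covariances of `(Δ_a^{(k)}⊗1 + t·[(Δ^{R_k} − Δ^1⊗1) + a((Q_k(v))ᴴQ_k(v) − Q^{(k)ᴴ}Q^{(k)})])⁻¹` CONVERGE with rate `L^{−k}`.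
[cite: King1986, Lemma 4.5 (4.32)/(4.38) p.674 (scalar template); Balaban1985BackgroundPropagators, (3.23)-(3.24) p.394 (shape)] [folklore] -/
theorem towerLimitRate_covLapTransported (hL : 2 ≤ L) (hd : 1 ≤ d) {R : (k : ℕ) → Fin d → (idx L M k → Matrix o o ℂ)}
    {α β αz βz : ℝ} (hV : ∀ p : o × o, LipschitzBackground L M (Vab L M R p) α β)
    (hz : ∀ p : o × o, BoundedBackground L M (Zab L M R p) αz βz) {v : (k : ℕ) → idx L M k → Matrix o o ℂ} {α' β' : ℝ}
    (hv : BlockTransporters L M v α' β') {t : ℂ} (ht : ‖t‖ * (kappaCol o d a α β αz + ‖(a : ℂ)‖ * (α' * (2 + α') * Cst d a)) < 1) :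
    TowerLimitRate (Ac L M (o := o)) ((L : ℝ) ^ d)
      (fun k => (Dc L M a ha k + t • (covPertC L M R k + (a : ℂ) • sitePert L M (o := o) v k))⁻¹)
      (Cpert (kappaCol o d a α β αz + ‖(a : ℂ)‖ * (α' * (2 + α') * Cst d a)) (2 * d * Cst d a) (CJ d a)
        (C2col o d L a α β βz + ‖(a : ℂ)‖ * C2site d a α' β') 0 t) ((L : ℝ)⁻¹) := by
  have hL1 : (1 : ℝ) < L := by exact_mod_cast (lt_of_lt_of_le one_lt_two hL : 1 < L)
  have hr : (0 : ℝ) < (L : ℝ) ^ d := pow_pos (lt_trans zero_lt_one hL1) d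
  refine towerLimitRate_perturbed hr (freeTowerLaws_c L M a ha) (perturbationLaws_covLapTransported L M a ha hd hV hz hv)
    (inv_lt_one_of_one_lt₀ hL1) (fun k => le_rfl) (fun k => le_rfl) (fun k => le_rfl) (fun k => ?_) ht
  simp only [zero_mul, le_refl]

/-- **THE PHYSICAL VALUE `t = 1`** under the DISPLAYED small-field threshold `κ_col + a·α′(2+α′)Cst < 1`. [folklore] -/
theorem covLapTransported_rate (hL : 2 ≤ L) (hd : 1 ≤ d) {R : (k : ℕ) → Fin d → (idx L M k → Matrix o o ℂ)} {α β αz βz : ℝ}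
    (hV : ∀ p : o × o, LipschitzBackground L M (Vab L M R p) α β) (hz : ∀ p : o × o, BoundedBackground L M (Zab L M R p) αz βz)
    {v : (k : ℕ) → idx L M k → Matrix o o ℂ} {α' β' : ℝ} (hv : BlockTransporters L M v α' β')
    (hsmall : kappaCol o d a α β αz + ‖(a : ℂ)‖ * (α' * (2 + α') * Cst d a) < 1) :
    TowerLimitRate (Ac L M (o := o)) ((L : ℝ) ^ d)
      (fun k => (Dc L M a ha k + (covPertC L M R k + (a : ℂ) • sitePert L M (o := o) v k))⁻¹)
      (Cpert (kappaCol o d a α β αz + ‖(a : ℂ)‖ * (α' * (2 + α') * Cst d a)) (2 * d * Cst d a) (CJ d a)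
        (C2col o d L a α β βz + ‖(a : ℂ)‖ * C2site d a α' β') 0 1) ((L : ℝ)⁻¹) := by
  have h := towerLimitRate_covLapTransported L M a ha hL hd hV hz hv (t := 1) (by rwa [norm_one, one_mul])
  simpa only [one_smul] using h

/-! ## §4 The DAG edge NE2(tier B, transporters) ⇐ NE3: `LocalRate` of the transporter readings ⇒ `BlockTransporters` -/

open Literature.MathematicalPhysics.QuantumFieldTheory.Balaban1983to89.T4EtaRateMin (LocalRate) in
/-- **NE3's CURRENCY ⇒ THE TRANSPORTER HYPOTHESIS** (`d ≥ 1`): if the class `𝒟` of direction-indexed colour towers has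
`LocalRate (bgReadings 𝒟) C L⁻¹` (node U1b/NE3's predicate, by name) and contains the tower `k ↦ (ν ↦ v_k)`, and the transporters are in the
small field `‖v_k(x) − 1‖ ≤ α′`, then `BlockTransporters L M v α′ (2·card o·C)`. [folklore] -/
theorem blockTransporters_of_localRate (hd : 1 ≤ d) {𝒟 : Set ((k : ℕ) → Fin d → (idx L M k → Matrix o o ℂ))} {C α' : ℝ} (hC : 0 ≤ C)
    (hα : 0 ≤ α') (h : LocalRate (NE2FromNE3.bgReadings L M 𝒟) C ((L : ℝ)⁻¹)) {v : (k : ℕ) → idx L M k → Matrix o o ℂ}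
    (hv𝒟 : (fun k (_ : Fin d) => v k) ∈ 𝒟) (hnear : ∀ k i, ‖v k i - 1‖ ≤ α') : BlockTransporters L M v α' (2 * (Fintype.card o : ℝ) * C) where
  nonneg := ⟨hα, by positivity⟩
  near_one := hnear
  consistent := fun k i => NE2FromNE3.consistent_of_localRate_lev L M hC h hv𝒟 k ⟨0, hd⟩ i

open Literature.MathematicalPhysics.QuantumFieldTheory.Balaban1983to89.T4EtaRateMin (LocalRate) in
/-- **THE TRANSPORTED-SITE η-RATE CONDITIONAL ON NE3 BY NAME** (`L ≥ 2`, `d ≥ 1`, `t = 1`, `c = a`): `LocalRate` of the transporter readings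
+ small field ⟹ the rate of `transportedSite_rate` with `β′ = 2·card o·C`.  HONEST: the hypothesis `h` IS node NE3's open predicate; nothing of
NE3 is proved here. [folklore] -/
theorem transportedSite_rate_of_localRate (hL : 2 ≤ L) (hd : 1 ≤ d) {𝒟 : Set ((k : ℕ) → Fin d → (idx L M k → Matrix o o ℂ))} {C α' : ℝ}
    (hC : 0 ≤ C) (hα : 0 ≤ α') (h : LocalRate (NE2FromNE3.bgReadings L M 𝒟) C ((L : ℝ)⁻¹)) {v : (k : ℕ) → idx L M k → Matrix o o ℂ}
    (hv𝒟 : (fun k (_ : Fin d) => v k) ∈ 𝒟) (hnear : ∀ k i, ‖v k i - 1‖ ≤ α') (hsmall : ‖(a : ℂ)‖ * (α' * (2 + α') * Cst d a) < 1) :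
    TowerLimitRate (Ac L M (o := o)) ((L : ℝ) ^ d) (fun k => (Dc L M a ha k + (a : ℂ) • sitePert L M (o := o) v k)⁻¹)
      (Cpert (‖(a : ℂ)‖ * (α' * (2 + α') * Cst d a)) (2 * d * Cst d a) (CJ d a) (‖(a : ℂ)‖ * C2site d a α' (2 * (Fintype.card o : ℝ) * C)) 0 1)
      ((L : ℝ)⁻¹) :=
  transportedSite_rate L M a ha hL (blockTransporters_of_localRate L M hd hC hα h hv𝒟 hnear) hsmall

end Summit.QuantumFields.BalabanUV.T4Continuum.TransportedSiteAveraging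

end
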